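import Mathlib.Tactic.Ring
import Mathlib.Tactic.Linarith
import Mathlib.Tactic.Positivity
import Mathlib.Tactic.LinearCombination
import Mathlib.Data.Real.Basic
import HarnessLib

/-!
# Conjecture N (hodge-weil ladder, GAPS G51b), format (5,3): PURE CHARGES ARE A LINE MEETING A QUINTIC; THE WALL LEMMA

Prover 2, generation 17 (note `run/shared/lean/b2b/hodge-weil/b2b-hweil-pv2-g17/REAL-N53-G17.md`). Setting of `CONJECTURE-N.md` §1, format
(5,3), real charges, centred coordinates (E-roots `(A_e,u_e)`, F-roots `(B_g,v_g)`; `S := S_u = Σu² − Σv²`; purity sums `P1, P2, P4`;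
`Q₄ = 3S_{u⁴} − (3/2)S²`; pairwise ampleness `|u_e − v_g| ≤ A_e − B_g`).
THE PICTURE (`lineId`). Put `p(t) := ∏_e (u_e − t)`, `P(t) := (t − v₁)(t − v₂)(t − v₃)(t² − S/2)` and let `ℓ` be the affine function
`ℓ(t) := (e₅(u) + e₃(v)·S/2) − (e₄(u) + e₂(v)·S/2)·t`. Then, given centring `Σu = Σv` only, `p(t) + P(t) − ℓ(t) = (t²/3)·P4` identically
in `t`. Hence ON THE PURE LOCUS THE FIVE E-CHARGES ARE THE INTERSECTIONS OF THE LINE `ℓ` WITH THE QUINTIC `P`, whose roots are the three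
F-charges and `±ρ`, `ρ² = S/2`; conversely any such picture is centred and satisfies P4. Corollaries: `ℓ(v_g) = K₀(g) := ∏_e(u_e − v_g)`
(the collinearity of pv2-g15/16 for free), `Q₄ = 12·slope(ℓ)` (`Q4_eq_slope`), and the WALL VALUES `w(u_e)·∏_g(u_e − v_g) = ℓ(u_e)` with
`w(x) := x² − S/2` the wall of pv2-g12/13 (`wall_eq_line_e`). THE WALL LEMMA (`transport`): for any reals with `Σ_e w_e = Σ_g z_g`,
`(Σ_g z_g)·(Σ_e w_eA_e − Σ_g z_gB_g) = Σ_{e,g} w_e z_g (A_e − B_g)`; with the walls `w_e = w(u_e)`, `z_g = w(v_g)` (their sums agree) and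
centred positions the second factor is `P2`, so if all eight walls have one strict sign, `P2 = 0` and dominance force `A_e = B_g` for all
pairs, ampleness forces all charges equal, and then every wall vanishes — contradiction (`chargesEqual_of_walls_neg/pos`,
`no_config_of_walls_neg/pos`). The companion file `WeilClassTestFormatFiveThreeEmptyPatterns.lean` uses this to empty the charge
patterns (2,2,3), (2,3,3) and, for `Q₄ < 0`, (2,2,2)/(3,3,3).
Pure algebra; nothing here is a case of HC, a rung or a door edge; no statement of Markman's papers is used. New cell result ⇒ Summits/.
-/

set_option linter.dupNamespace false

namespace Summit.HodgeConjecture.HodgeConjecture.WeilClassTestFormatFiveThreeLineQuintic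

/-- THE LINE–QUINTIC IDENTITY (format (5,3), centring only): for every `t`,
`∏_e(u_e − t) + (t − v₁)(t − v₂)(t − v₃)(t² − S/2) − ℓ(t) = (t²/3)·P4`, `S = Σu² − Σv²`,
`ℓ(t) = (e₅(u) + e₃(v)S/2) − (e₄(u) + e₂(v)S/2)·t`. On the pure locus the E-charges are the intersections of the line `ℓ` with the quintic
whose roots are `v₁, v₂, v₃, ±√(S/2)`. -/
theorem lineId (t : ℝ) (u₁ u₂ u₃ u₄ u₅ v₁ v₂ v₃ : ℝ)
    (hC : u₁ + u₂ + u₃ + u₄ + u₅ = v₁ + v₂ + v₃) :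
    ((u₁ - t) * (u₂ - t) * (u₃ - t) * (u₄ - t) * (u₅ - t)) + ((t - v₁) * (t - v₂) * (t - v₃) * (t ^ 2 - ((u₁ ^ 2 + u₂ ^ 2 + u₃ ^ 2 + u₄ ^ 2 + u₅ ^ 2) - (v₁ ^ 2 + v₂ ^ 2 + v₃ ^ 2)) / 2))
      - (((u₁ * u₂ * u₃ * u₄ * u₅) + (v₁ * v₂ * v₃) * ((u₁ ^ 2 + u₂ ^ 2 + u₃ ^ 2 + u₄ ^ 2 + u₅ ^ 2) - (v₁ ^ 2 + v₂ ^ 2 + v₃ ^ 2)) / 2) + (-((u₁ * u₂ * u₃ * u₄ + u₁ * u₂ * u₃ * u₅ + u₁ * u₂ * u₄ * u₅ + u₁ * u₃ * u₄ * u₅ + u₂ * u₃ * u₄ * u₅) + (v₁ * v₂ + v₁ * v₃ + v₂ * v₃) * ((u₁ ^ 2 + u₂ ^ 2 + u₃ ^ 2 + u₄ ^ 2 + u₅ ^ 2) - (v₁ ^ 2 + v₂ ^ 2 + v₃ ^ 2)) / 2)) * t)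
      = t ^ 2 / 3 * ((u₁ ^ 3 + u₂ ^ 3 + u₃ ^ 3 + u₄ ^ 3 + u₅ ^ 3) - (v₁ ^ 3 + v₂ ^ 3 + v₃ ^ 3)) := by
  have hv : v₃ = u₁ + u₂ + u₃ + u₄ + u₅ - v₁ - v₂ := by linarith
  subst hv
  ring

/-- Second-derivative form of `lineId`: `p''(t) + P''(t) = (2/3)·P4` (`ℓ'' = 0`), with `p'' = 2Σ_{i<j}∏_{k∉{i,j}}(u_k − t)` and
`P'' = C''·(t² − S/2) + 4t·C' + 2C`, `C(t) = ∏_g(t − v_g)`. -/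
theorem lineId_dd (t : ℝ) (u₁ u₂ u₃ u₄ u₅ v₁ v₂ v₃ : ℝ)
    (hC : u₁ + u₂ + u₃ + u₄ + u₅ = v₁ + v₂ + v₃) :
    (2 * ((u₃ - t) * (u₄ - t) * (u₅ - t) + (u₂ - t) * (u₄ - t) * (u₅ - t) + (u₂ - t) * (u₃ - t) * (u₅ - t) + (u₂ - t) * (u₃ - t) * (u₄ - t) + (u₁ - t) * (u₄ - t) * (u₅ - t) + (u₁ - t) * (u₃ - t) * (u₅ - t) + (u₁ - t) * (u₃ - t) * (u₄ - t) + (u₁ - t) * (u₂ - t) * (u₅ - t) + (u₁ - t) * (u₂ - t) * (u₄ - t) + (u₁ - t) * (u₂ - t) * (u₃ - t)))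
      + ((2 * ((t - v₁) + (t - v₂) + (t - v₃))) * (t ^ 2 - ((u₁ ^ 2 + u₂ ^ 2 + u₃ ^ 2 + u₄ ^ 2 + u₅ ^ 2) - (v₁ ^ 2 + v₂ ^ 2 + v₃ ^ 2)) / 2) + 4 * t * ((t - v₂) * (t - v₃) + (t - v₁) * (t - v₃) + (t - v₁) * (t - v₂)) + 2 * ((t - v₁) * (t - v₂) * (t - v₃)))
      = 2 / 3 * ((u₁ ^ 3 + u₂ ^ 3 + u₃ ^ 3 + u₄ ^ 3 + u₅ ^ 3) - (v₁ ^ 3 + v₂ ^ 3 + v₃ ^ 3)) := by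
  have hv : v₃ = u₁ + u₂ + u₃ + u₄ + u₅ - v₁ - v₂ := by linarith
  subst hv
  ring

/-- `Q₄` IS TWELVE TIMES THE SLOPE OF THE LINE: `Q₄ = 12·(−(e₄(u) + e₂(v)S/2)) + 4(v₁ + v₂ + v₃)·P4` (centring only). -/
theorem Q4_eq_slope (u₁ u₂ u₃ u₄ u₅ v₁ v₂ v₃ : ℝ)
    (hC : u₁ + u₂ + u₃ + u₄ + u₅ = v₁ + v₂ + v₃) :
    (3 * ((u₁ ^ 4 + u₂ ^ 4 + u₃ ^ 4 + u₄ ^ 4 + u₅ ^ 4) - (v₁ ^ 4 + v₂ ^ 4 + v₃ ^ 4)) - (3 / 2) * ((u₁ ^ 2 + u₂ ^ 2 + u₃ ^ 2 + u₄ ^ 2 + u₅ ^ 2) - (v₁ ^ 2 + v₂ ^ 2 + v₃ ^ 2)) ^ 2)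
      = 12 * (-((u₁ * u₂ * u₃ * u₄ + u₁ * u₂ * u₃ * u₅ + u₁ * u₂ * u₄ * u₅ + u₁ * u₃ * u₄ * u₅ + u₂ * u₃ * u₄ * u₅) + (v₁ * v₂ + v₁ * v₃ + v₂ * v₃) * ((u₁ ^ 2 + u₂ ^ 2 + u₃ ^ 2 + u₄ ^ 2 + u₅ ^ 2) - (v₁ ^ 2 + v₂ ^ 2 + v₃ ^ 2)) / 2))
        + 4 * (v₁ + v₂ + v₃) * ((u₁ ^ 3 + u₂ ^ 3 + u₃ ^ 3 + u₄ ^ 3 + u₅ ^ 3) - (v₁ ^ 3 + v₂ ^ 3 + v₃ ^ 3)) := by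
  have hv : v₃ = u₁ + u₂ + u₃ + u₄ + u₅ - v₁ - v₂ := by linarith
  subst hv
  ring

/-- On the pure locus `K₀(1) = ∏_e(u_e − v₁) = ℓ(v₁)` (the line passes through `(v_g, K₀(g))`: collinearity). -/
theorem K0_eq_line₁ (u₁ u₂ u₃ u₄ u₅ v₁ v₂ v₃ : ℝ)
    (hC : u₁ + u₂ + u₃ + u₄ + u₅ = v₁ + v₂ + v₃)
    (hP4 : (u₁ ^ 3 + u₂ ^ 3 + u₃ ^ 3 + u₄ ^ 3 + u₅ ^ 3) - (v₁ ^ 3 + v₂ ^ 3 + v₃ ^ 3) = 0) :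
    (u₁ - v₁) * (u₂ - v₁) * (u₃ - v₁) * (u₄ - v₁) * (u₅ - v₁) = (((u₁ * u₂ * u₃ * u₄ * u₅) + (v₁ * v₂ * v₃) * ((u₁ ^ 2 + u₂ ^ 2 + u₃ ^ 2 + u₄ ^ 2 + u₅ ^ 2) - (v₁ ^ 2 + v₂ ^ 2 + v₃ ^ 2)) / 2) + (-((u₁ * u₂ * u₃ * u₄ + u₁ * u₂ * u₃ * u₅ + u₁ * u₂ * u₄ * u₅ + u₁ * u₃ * u₄ * u₅ + u₂ * u₃ * u₄ * u₅) + (v₁ * v₂ + v₁ * v₃ + v₂ * v₃) * ((u₁ ^ 2 + u₂ ^ 2 + u₃ ^ 2 + u₄ ^ 2 + u₅ ^ 2) - (v₁ ^ 2 + v₂ ^ 2 + v₃ ^ 2)) / 2)) * v₁) := by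
  have h := lineId v₁ u₁ u₂ u₃ u₄ u₅ v₁ v₂ v₃ hC
  linear_combination h + (v₁ ^ 2 / 3) * hP4

/-- On the pure locus `K₀(2) = ∏_e(u_e − v₂) = ℓ(v₂)` (the line passes through `(v_g, K₀(g))`: collinearity). -/
theorem K0_eq_line₂ (u₁ u₂ u₃ u₄ u₅ v₁ v₂ v₃ : ℝ)
    (hC : u₁ + u₂ + u₃ + u₄ + u₅ = v₁ + v₂ + v₃)
    (hP4 : (u₁ ^ 3 + u₂ ^ 3 + u₃ ^ 3 + u₄ ^ 3 + u₅ ^ 3) - (v₁ ^ 3 + v₂ ^ 3 + v₃ ^ 3) = 0) :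
    (u₁ - v₂) * (u₂ - v₂) * (u₃ - v₂) * (u₄ - v₂) * (u₅ - v₂) = (((u₁ * u₂ * u₃ * u₄ * u₅) + (v₁ * v₂ * v₃) * ((u₁ ^ 2 + u₂ ^ 2 + u₃ ^ 2 + u₄ ^ 2 + u₅ ^ 2) - (v₁ ^ 2 + v₂ ^ 2 + v₃ ^ 2)) / 2) + (-((u₁ * u₂ * u₃ * u₄ + u₁ * u₂ * u₃ * u₅ + u₁ * u₂ * u₄ * u₅ + u₁ * u₃ * u₄ * u₅ + u₂ * u₃ * u₄ * u₅) + (v₁ * v₂ + v₁ * v₃ + v₂ * v₃) * ((u₁ ^ 2 + u₂ ^ 2 + u₃ ^ 2 + u₄ ^ 2 + u₅ ^ 2) - (v₁ ^ 2 + v₂ ^ 2 + v₃ ^ 2)) / 2)) * v₂) := by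
  have h := lineId v₂ u₁ u₂ u₃ u₄ u₅ v₁ v₂ v₃ hC
  linear_combination h + (v₂ ^ 2 / 3) * hP4

/-- On the pure locus `K₀(3) = ∏_e(u_e − v₃) = ℓ(v₃)` (the line passes through `(v_g, K₀(g))`: collinearity). -/
theorem K0_eq_line₃ (u₁ u₂ u₃ u₄ u₅ v₁ v₂ v₃ : ℝ)
    (hC : u₁ + u₂ + u₃ + u₄ + u₅ = v₁ + v₂ + v₃)
    (hP4 : (u₁ ^ 3 + u₂ ^ 3 + u₃ ^ 3 + u₄ ^ 3 + u₅ ^ 3) - (v₁ ^ 3 + v₂ ^ 3 + v₃ ^ 3) = 0) :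
    (u₁ - v₃) * (u₂ - v₃) * (u₃ - v₃) * (u₄ - v₃) * (u₅ - v₃) = (((u₁ * u₂ * u₃ * u₄ * u₅) + (v₁ * v₂ * v₃) * ((u₁ ^ 2 + u₂ ^ 2 + u₃ ^ 2 + u₄ ^ 2 + u₅ ^ 2) - (v₁ ^ 2 + v₂ ^ 2 + v₃ ^ 2)) / 2) + (-((u₁ * u₂ * u₃ * u₄ + u₁ * u₂ * u₃ * u₅ + u₁ * u₂ * u₄ * u₅ + u₁ * u₃ * u₄ * u₅ + u₂ * u₃ * u₄ * u₅) + (v₁ * v₂ + v₁ * v₃ + v₂ * v₃) * ((u₁ ^ 2 + u₂ ^ 2 + u₃ ^ 2 + u₄ ^ 2 + u₅ ^ 2) - (v₁ ^ 2 + v₂ ^ 2 + v₃ ^ 2)) / 2)) * v₃) := by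
  have h := lineId v₃ u₁ u₂ u₃ u₄ u₅ v₁ v₂ v₃ hC
  linear_combination h + (v₃ ^ 2 / 3) * hP4

/-- WALL VALUE of the E-charge `u₁` on the pure locus: `(u₁² − S/2)·∏_g(u₁ − v_g) = ℓ(u₁)`. -/
theorem wall_eq_line₁ (u₁ u₂ u₃ u₄ u₅ v₁ v₂ v₃ : ℝ)
    (hC : u₁ + u₂ + u₃ + u₄ + u₅ = v₁ + v₂ + v₃)
    (hP4 : (u₁ ^ 3 + u₂ ^ 3 + u₃ ^ 3 + u₄ ^ 3 + u₅ ^ 3) - (v₁ ^ 3 + v₂ ^ 3 + v₃ ^ 3) = 0) :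
    (u₁ ^ 2 - ((u₁ ^ 2 + u₂ ^ 2 + u₃ ^ 2 + u₄ ^ 2 + u₅ ^ 2) - (v₁ ^ 2 + v₂ ^ 2 + v₃ ^ 2)) / 2) * ((u₁ - v₁) * (u₁ - v₂) * (u₁ - v₃)) = (((u₁ * u₂ * u₃ * u₄ * u₅) + (v₁ * v₂ * v₃) * ((u₁ ^ 2 + u₂ ^ 2 + u₃ ^ 2 + u₄ ^ 2 + u₅ ^ 2) - (v₁ ^ 2 + v₂ ^ 2 + v₃ ^ 2)) / 2) + (-((u₁ * u₂ * u₃ * u₄ + u₁ * u₂ * u₃ * u₅ + u₁ * u₂ * u₄ * u₅ + u₁ * u₃ * u₄ * u₅ + u₂ * u₃ * u₄ * u₅) + (v₁ * v₂ + v₁ * v₃ + v₂ * v₃) * ((u₁ ^ 2 + u₂ ^ 2 + u₃ ^ 2 + u₄ ^ 2 + u₅ ^ 2) - (v₁ ^ 2 + v₂ ^ 2 + v₃ ^ 2)) / 2)) * u₁) := by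
  have h := lineId u₁ u₁ u₂ u₃ u₄ u₅ v₁ v₂ v₃ hC
  linear_combination h + (u₁ ^ 2 / 3) * hP4

/-- WALL VALUE of the E-charge `u₂` on the pure locus: `(u₂² − S/2)·∏_g(u₂ − v_g) = ℓ(u₂)`. -/
theorem wall_eq_line₂ (u₁ u₂ u₃ u₄ u₅ v₁ v₂ v₃ : ℝ)
    (hC : u₁ + u₂ + u₃ + u₄ + u₅ = v₁ + v₂ + v₃)
    (hP4 : (u₁ ^ 3 + u₂ ^ 3 + u₃ ^ 3 + u₄ ^ 3 + u₅ ^ 3) - (v₁ ^ 3 + v₂ ^ 3 + v₃ ^ 3) = 0) :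
    (u₂ ^ 2 - ((u₁ ^ 2 + u₂ ^ 2 + u₃ ^ 2 + u₄ ^ 2 + u₅ ^ 2) - (v₁ ^ 2 + v₂ ^ 2 + v₃ ^ 2)) / 2) * ((u₂ - v₁) * (u₂ - v₂) * (u₂ - v₃)) = (((u₁ * u₂ * u₃ * u₄ * u₅) + (v₁ * v₂ * v₃) * ((u₁ ^ 2 + u₂ ^ 2 + u₃ ^ 2 + u₄ ^ 2 + u₅ ^ 2) - (v₁ ^ 2 + v₂ ^ 2 + v₃ ^ 2)) / 2) + (-((u₁ * u₂ * u₃ * u₄ + u₁ * u₂ * u₃ * u₅ + u₁ * u₂ * u₄ * u₅ + u₁ * u₃ * u₄ * u₅ + u₂ * u₃ * u₄ * u₅) + (v₁ * v₂ + v₁ * v₃ + v₂ * v₃) * ((u₁ ^ 2 + u₂ ^ 2 + u₃ ^ 2 + u₄ ^ 2 + u₅ ^ 2) - (v₁ ^ 2 + v₂ ^ 2 + v₃ ^ 2)) / 2)) * u₂) := by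
  have h := lineId u₂ u₁ u₂ u₃ u₄ u₅ v₁ v₂ v₃ hC
  linear_combination h + (u₂ ^ 2 / 3) * hP4

/-- WALL VALUE of the E-charge `u₃` on the pure locus: `(u₃² − S/2)·∏_g(u₃ − v_g) = ℓ(u₃)`. -/
theorem wall_eq_line₃ (u₁ u₂ u₃ u₄ u₅ v₁ v₂ v₃ : ℝ)
    (hC : u₁ + u₂ + u₃ + u₄ + u₅ = v₁ + v₂ + v₃)
    (hP4 : (u₁ ^ 3 + u₂ ^ 3 + u₃ ^ 3 + u₄ ^ 3 + u₅ ^ 3) - (v₁ ^ 3 + v₂ ^ 3 + v₃ ^ 3) = 0) :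
    (u₃ ^ 2 - ((u₁ ^ 2 + u₂ ^ 2 + u₃ ^ 2 + u₄ ^ 2 + u₅ ^ 2) - (v₁ ^ 2 + v₂ ^ 2 + v₃ ^ 2)) / 2) * ((u₃ - v₁) * (u₃ - v₂) * (u₃ - v₃)) = (((u₁ * u₂ * u₃ * u₄ * u₅) + (v₁ * v₂ * v₃) * ((u₁ ^ 2 + u₂ ^ 2 + u₃ ^ 2 + u₄ ^ 2 + u₅ ^ 2) - (v₁ ^ 2 + v₂ ^ 2 + v₃ ^ 2)) / 2) + (-((u₁ * u₂ * u₃ * u₄ + u₁ * u₂ * u₃ * u₅ + u₁ * u₂ * u₄ * u₅ + u₁ * u₃ * u₄ * u₅ + u₂ * u₃ * u₄ * u₅) + (v₁ * v₂ + v₁ * v₃ + v₂ * v₃) * ((u₁ ^ 2 + u₂ ^ 2 + u₃ ^ 2 + u₄ ^ 2 + u₅ ^ 2) - (v₁ ^ 2 + v₂ ^ 2 + v₃ ^ 2)) / 2)) * u₃) := by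
  have h := lineId u₃ u₁ u₂ u₃ u₄ u₅ v₁ v₂ v₃ hC
  linear_combination h + (u₃ ^ 2 / 3) * hP4

/-- WALL VALUE of the E-charge `u₄` on the pure locus: `(u₄² − S/2)·∏_g(u₄ − v_g) = ℓ(u₄)`. -/
theorem wall_eq_line₄ (u₁ u₂ u₃ u₄ u₅ v₁ v₂ v₃ : ℝ)
    (hC : u₁ + u₂ + u₃ + u₄ + u₅ = v₁ + v₂ + v₃)
    (hP4 : (u₁ ^ 3 + u₂ ^ 3 + u₃ ^ 3 + u₄ ^ 3 + u₅ ^ 3) - (v₁ ^ 3 + v₂ ^ 3 + v₃ ^ 3) = 0) :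
    (u₄ ^ 2 - ((u₁ ^ 2 + u₂ ^ 2 + u₃ ^ 2 + u₄ ^ 2 + u₅ ^ 2) - (v₁ ^ 2 + v₂ ^ 2 + v₃ ^ 2)) / 2) * ((u₄ - v₁) * (u₄ - v₂) * (u₄ - v₃)) = (((u₁ * u₂ * u₃ * u₄ * u₅) + (v₁ * v₂ * v₃) * ((u₁ ^ 2 + u₂ ^ 2 + u₃ ^ 2 + u₄ ^ 2 + u₅ ^ 2) - (v₁ ^ 2 + v₂ ^ 2 + v₃ ^ 2)) / 2) + (-((u₁ * u₂ * u₃ * u₄ + u₁ * u₂ * u₃ * u₅ + u₁ * u₂ * u₄ * u₅ + u₁ * u₃ * u₄ * u₅ + u₂ * u₃ * u₄ * u₅) + (v₁ * v₂ + v₁ * v₃ + v₂ * v₃) * ((u₁ ^ 2 + u₂ ^ 2 + u₃ ^ 2 + u₄ ^ 2 + u₅ ^ 2) - (v₁ ^ 2 + v₂ ^ 2 + v₃ ^ 2)) / 2)) * u₄) := by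
  have h := lineId u₄ u₁ u₂ u₃ u₄ u₅ v₁ v₂ v₃ hC
  linear_combination h + (u₄ ^ 2 / 3) * hP4

/-- WALL VALUE of the E-charge `u₅` on the pure locus: `(u₅² − S/2)·∏_g(u₅ − v_g) = ℓ(u₅)`. -/
theorem wall_eq_line₅ (u₁ u₂ u₃ u₄ u₅ v₁ v₂ v₃ : ℝ)
    (hC : u₁ + u₂ + u₃ + u₄ + u₅ = v₁ + v₂ + v₃)
    (hP4 : (u₁ ^ 3 + u₂ ^ 3 + u₃ ^ 3 + u₄ ^ 3 + u₅ ^ 3) - (v₁ ^ 3 + v₂ ^ 3 + v₃ ^ 3) = 0) :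
    (u₅ ^ 2 - ((u₁ ^ 2 + u₂ ^ 2 + u₃ ^ 2 + u₄ ^ 2 + u₅ ^ 2) - (v₁ ^ 2 + v₂ ^ 2 + v₃ ^ 2)) / 2) * ((u₅ - v₁) * (u₅ - v₂) * (u₅ - v₃)) = (((u₁ * u₂ * u₃ * u₄ * u₅) + (v₁ * v₂ * v₃) * ((u₁ ^ 2 + u₂ ^ 2 + u₃ ^ 2 + u₄ ^ 2 + u₅ ^ 2) - (v₁ ^ 2 + v₂ ^ 2 + v₃ ^ 2)) / 2) + (-((u₁ * u₂ * u₃ * u₄ + u₁ * u₂ * u₃ * u₅ + u₁ * u₂ * u₄ * u₅ + u₁ * u₃ * u₄ * u₅ + u₂ * u₃ * u₄ * u₅) + (v₁ * v₂ + v₁ * v₃ + v₂ * v₃) * ((u₁ ^ 2 + u₂ ^ 2 + u₃ ^ 2 + u₄ ^ 2 + u₅ ^ 2) - (v₁ ^ 2 + v₂ ^ 2 + v₃ ^ 2)) / 2)) * u₅) := by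
  have h := lineId u₅ u₁ u₂ u₃ u₄ u₅ v₁ v₂ v₃ hC
  linear_combination h + (u₅ ^ 2 / 3) * hP4

/-- THE WALL LEMMA, transport form: if `w₁ + … + w₅ = z₁ + z₂ + z₃` then
`(z₁ + z₂ + z₃)·(Σ_e w_e A_e − Σ_g z_g B_g) = Σ_{e,g} w_e z_g (A_e − B_g)`. With `w_e = u_e² − S/2`, `z_g = v_g² − S/2` (the walls;
their sums agree by the definition of `S`) and centred positions, `Σ_e w_e A_e − Σ_g z_g B_g = P2`: so `W·P2` is a nonnegative combination
of the dominances `A_e − B_g` whenever all walls have one sign. -/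
theorem transport (w₁ w₂ w₃ w₄ w₅ z₁ z₂ z₃ A₁ A₂ A₃ A₄ A₅ B₁ B₂ B₃ : ℝ)
    (hW : w₁ + w₂ + w₃ + w₄ + w₅ = z₁ + z₂ + z₃) :
    (z₁ + z₂ + z₃) * ((w₁ * A₁ + w₂ * A₂ + w₃ * A₃ + w₄ * A₄ + w₅ * A₅) - (z₁ * B₁ + z₂ * B₂ + z₃ * B₃))
      = (w₁ * z₁ * (A₁ - B₁)
        + w₂ * z₁ * (A₂ - B₁)
        + w₃ * z₁ * (A₃ - B₁)
        + w₄ * z₁ * (A₄ - B₁)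
        + w₅ * z₁ * (A₅ - B₁)
        + w₁ * z₂ * (A₁ - B₂)
        + w₂ * z₂ * (A₂ - B₂)
        + w₃ * z₂ * (A₃ - B₂)
        + w₄ * z₂ * (A₄ - B₂)
        + w₅ * z₂ * (A₅ - B₂)
        + w₁ * z₃ * (A₁ - B₃)
        + w₂ * z₃ * (A₂ - B₃)
        + w₃ * z₃ * (A₃ - B₃)
        + w₄ * z₃ * (A₄ - B₃)
        + w₅ * z₃ * (A₅ - B₃)) := by
  have hz : z₃ = w₁ + w₂ + w₃ + w₄ + w₅ - z₁ - z₂ := by linarith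
  subst hz
  ring

/-- sign helper: a positive product with a negative second factor has a negative first factor. -/
theorem neg_of_mul_pos_of_neg (a b : ℝ) (h : 0 < a * b) (hb : b < 0) : a < 0 := by nlinarith
/-- sign helper: a negative product with a positive second factor has a negative first factor. -/
theorem neg_of_mul_neg_of_pos (a b : ℝ) (h : a * b < 0) (hb : 0 < b) : a < 0 := by nlinarith
/-- sign helper: `0 < c`, `0 < c·b` ⟹ `0 < b`. -/
theorem pos_of_pos_mul (c b : ℝ) (hc : 0 < c) (h : 0 < c * b) : 0 < b := by nlinarith
/-- sign helper: `0 < c`, `c·b < 0` ⟹ `b < 0`. -/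
theorem neg_of_pos_mul_neg (c b : ℝ) (hc : 0 < c) (h : c * b < 0) : b < 0 := by nlinarith
/-- sign helper: nonnegative product with positive second factor has nonnegative first factor. -/
theorem nonneg_of_mul_nonneg_of_pos (a b : ℝ) (h : 0 ≤ a * b) (hb : 0 < b) : 0 ≤ a := by nlinarith
/-- sign helper: product of two nonpositive reals is nonnegative. -/
theorem mul_nonneg_of_nonpos_nonpos (a b : ℝ) (ha : a ≤ 0) (hb : b ≤ 0) : 0 ≤ a * b := by nlinarith
/-- wall helper: `a < b`, `a² < s/2 ≤ b²` ⟹ `0 < b`. -/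
theorem pos_of_wall_lt (a b s : ℝ) (hab : a < b) (ha : a ^ 2 - s / 2 < 0) (hb : 0 ≤ b ^ 2 - s / 2) : 0 < b := by
  nlinarith [mul_nonneg (sub_nonneg.mpr hab.le) (sub_nonneg.mpr hab.le)]
/-- wall helper: the wall is nondecreasing on the positive axis. -/
theorem wall_mono (a b s : ℝ) (ha : 0 < a) (hab : a ≤ b) : a ^ 2 - s / 2 ≤ b ^ 2 - s / 2 := by
  nlinarith [mul_nonneg (sub_nonneg.mpr hab) (by linarith : (0:ℝ) ≤ a + b)]
/-- sign helper: `a < 0`, `0 ≤ a·b` ⟹ `b ≤ 0`. -/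
theorem nonpos_of_neg_mul_nonneg (a b : ℝ) (ha : a < 0) (h : 0 ≤ a * b) : b ≤ 0 := by nlinarith
/-- convexity of the wall: if `a ≤ x ≤ b` and both `a² < s/2`, `b² < s/2` then `x² < s/2`. -/
theorem wall_neg_between (a x b s : ℝ) (hax : a ≤ x) (hxb : x ≤ b) (ha : a ^ 2 - s / 2 < 0) (hb : b ^ 2 - s / 2 < 0) :
    x ^ 2 - s / 2 < 0 := by
  rcases le_or_gt 0 x with hx | hx
  · have : x ^ 2 ≤ b ^ 2 := by nlinarith [mul_nonneg (sub_nonneg.mpr hxb) (add_nonneg (hx.trans hxb) hx)]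
    linarith
  · have : x ^ 2 ≤ a ^ 2 := by nlinarith [mul_nonneg (sub_nonneg.mpr hax) (by linarith : (0:ℝ) ≤ -(a + x))]
    linarith

/-- Abstract core of the wall lemma's consequence (negative walls): if `Σw_e = Σz_g`, `Σ_e w_eA_e = Σ_g z_gB_g`,
all `w_e, z_g` are negative and the fifteen pairs are ample, then all eight charges coincide. -/
theorem chargesEqual_of_walls_neg (w₁ w₂ w₃ w₄ w₅ z₁ z₂ z₃ A₁ A₂ A₃ A₄ A₅ B₁ B₂ B₃ u₁ u₂ u₃ u₄ u₅ v₁ v₂ v₃ : ℝ)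
    (hW : w₁ + w₂ + w₃ + w₄ + w₅ = z₁ + z₂ + z₃)
    (hP : (w₁ * A₁ + w₂ * A₂ + w₃ * A₃ + w₄ * A₄ + w₅ * A₅) - (z₁ * B₁ + z₂ * B₂ + z₃ * B₃) = 0)
    (m₁₁ : |u₁ - v₁| ≤ A₁ - B₁) (m₂₁ : |u₂ - v₁| ≤ A₂ - B₁) (m₃₁ : |u₃ - v₁| ≤ A₃ - B₁) (m₄₁ : |u₄ - v₁| ≤ A₄ - B₁) (m₅₁ : |u₅ - v₁| ≤ A₅ - B₁)
    (m₁₂ : |u₁ - v₂| ≤ A₁ - B₂) (m₂₂ : |u₂ - v₂| ≤ A₂ - B₂) (m₃₂ : |u₃ - v₂| ≤ A₃ - B₂) (m₄₂ : |u₄ - v₂| ≤ A₄ - B₂) (m₅₂ : |u₅ - v₂| ≤ A₅ - B₂)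
    (m₁₃ : |u₁ - v₃| ≤ A₁ - B₃) (m₂₃ : |u₂ - v₃| ≤ A₂ - B₃) (m₃₃ : |u₃ - v₃| ≤ A₃ - B₃) (m₄₃ : |u₄ - v₃| ≤ A₄ - B₃) (m₅₃ : |u₅ - v₃| ≤ A₅ - B₃)
    (hw₁ : w₁ < 0) (hw₂ : w₂ < 0) (hw₃ : w₃ < 0) (hw₄ : w₄ < 0) (hw₅ : w₅ < 0)
    (hz₁ : z₁ < 0) (hz₂ : z₂ < 0) (hz₃ : z₃ < 0) :
    u₁ = v₁ ∧ u₂ = v₁ ∧ u₃ = v₁ ∧ u₄ = v₁ ∧ u₅ = v₁ ∧ v₂ = u₁ ∧ v₃ = u₁ := by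
  have key := transport w₁ w₂ w₃ w₄ w₅ z₁ z₂ z₃ A₁ A₂ A₃ A₄ A₅ B₁ B₂ B₃ hW
  rw [hP, mul_zero] at key
  have t₁₁ : 0 ≤ w₁ * z₁ * (A₁ - B₁) :=
    mul_nonneg (le_of_lt (mul_pos_of_neg_of_neg hw₁ hz₁)) ((abs_nonneg _).trans m₁₁)
  have t₂₁ : 0 ≤ w₂ * z₁ * (A₂ - B₁) :=
    mul_nonneg (le_of_lt (mul_pos_of_neg_of_neg hw₂ hz₁)) ((abs_nonneg _).trans m₂₁)
  have t₃₁ : 0 ≤ w₃ * z₁ * (A₃ - B₁) :=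
    mul_nonneg (le_of_lt (mul_pos_of_neg_of_neg hw₃ hz₁)) ((abs_nonneg _).trans m₃₁)
  have t₄₁ : 0 ≤ w₄ * z₁ * (A₄ - B₁) :=
    mul_nonneg (le_of_lt (mul_pos_of_neg_of_neg hw₄ hz₁)) ((abs_nonneg _).trans m₄₁)
  have t₅₁ : 0 ≤ w₅ * z₁ * (A₅ - B₁) :=
    mul_nonneg (le_of_lt (mul_pos_of_neg_of_neg hw₅ hz₁)) ((abs_nonneg _).trans m₅₁)
  have t₁₂ : 0 ≤ w₁ * z₂ * (A₁ - B₂) :=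
    mul_nonneg (le_of_lt (mul_pos_of_neg_of_neg hw₁ hz₂)) ((abs_nonneg _).trans m₁₂)
  have t₂₂ : 0 ≤ w₂ * z₂ * (A₂ - B₂) :=
    mul_nonneg (le_of_lt (mul_pos_of_neg_of_neg hw₂ hz₂)) ((abs_nonneg _).trans m₂₂)
  have t₃₂ : 0 ≤ w₃ * z₂ * (A₃ - B₂) :=
    mul_nonneg (le_of_lt (mul_pos_of_neg_of_neg hw₃ hz₂)) ((abs_nonneg _).trans m₃₂)
  have t₄₂ : 0 ≤ w₄ * z₂ * (A₄ - B₂) :=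
    mul_nonneg (le_of_lt (mul_pos_of_neg_of_neg hw₄ hz₂)) ((abs_nonneg _).trans m₄₂)
  have t₅₂ : 0 ≤ w₅ * z₂ * (A₅ - B₂) :=
    mul_nonneg (le_of_lt (mul_pos_of_neg_of_neg hw₅ hz₂)) ((abs_nonneg _).trans m₅₂)
  have t₁₃ : 0 ≤ w₁ * z₃ * (A₁ - B₃) :=
    mul_nonneg (le_of_lt (mul_pos_of_neg_of_neg hw₁ hz₃)) ((abs_nonneg _).trans m₁₃)
  have t₂₃ : 0 ≤ w₂ * z₃ * (A₂ - B₃) :=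
    mul_nonneg (le_of_lt (mul_pos_of_neg_of_neg hw₂ hz₃)) ((abs_nonneg _).trans m₂₃)
  have t₃₃ : 0 ≤ w₃ * z₃ * (A₃ - B₃) :=
    mul_nonneg (le_of_lt (mul_pos_of_neg_of_neg hw₃ hz₃)) ((abs_nonneg _).trans m₃₃)
  have t₄₃ : 0 ≤ w₄ * z₃ * (A₄ - B₃) :=
    mul_nonneg (le_of_lt (mul_pos_of_neg_of_neg hw₄ hz₃)) ((abs_nonneg _).trans m₄₃)
  have t₅₃ : 0 ≤ w₅ * z₃ * (A₅ - B₃) :=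
    mul_nonneg (le_of_lt (mul_pos_of_neg_of_neg hw₅ hz₃)) ((abs_nonneg _).trans m₅₃)
  have e₁₁ : w₁ * z₁ * (A₁ - B₁) = 0 := by linarith only [key, t₁₁, t₂₁, t₃₁, t₄₁, t₅₁, t₁₂, t₂₂, t₃₂, t₄₂, t₅₂, t₁₃, t₂₃, t₃₃, t₄₃, t₅₃]
  have d₁₁ : A₁ - B₁ = 0 := (mul_eq_zero.mp e₁₁).resolve_left (ne_of_gt (mul_pos_of_neg_of_neg hw₁ hz₁))
  have q₁₁ : u₁ - v₁ = 0 := by have h := m₁₁; rw [d₁₁] at h; exact abs_nonpos_iff.mp h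
  have e₂₁ : w₂ * z₁ * (A₂ - B₁) = 0 := by linarith only [key, t₁₁, t₂₁, t₃₁, t₄₁, t₅₁, t₁₂, t₂₂, t₃₂, t₄₂, t₅₂, t₁₃, t₂₃, t₃₃, t₄₃, t₅₃]
  have d₂₁ : A₂ - B₁ = 0 := (mul_eq_zero.mp e₂₁).resolve_left (ne_of_gt (mul_pos_of_neg_of_neg hw₂ hz₁))
  have q₂₁ : u₂ - v₁ = 0 := by have h := m₂₁; rw [d₂₁] at h; exact abs_nonpos_iff.mp h
  have e₃₁ : w₃ * z₁ * (A₃ - B₁) = 0 := by linarith only [key, t₁₁, t₂₁, t₃₁, t₄₁, t₅₁, t₁₂, t₂₂, t₃₂, t₄₂, t₅₂, t₁₃, t₂₃, t₃₃, t₄₃, t₅₃]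
  have d₃₁ : A₃ - B₁ = 0 := (mul_eq_zero.mp e₃₁).resolve_left (ne_of_gt (mul_pos_of_neg_of_neg hw₃ hz₁))
  have q₃₁ : u₃ - v₁ = 0 := by have h := m₃₁; rw [d₃₁] at h; exact abs_nonpos_iff.mp h
  have e₄₁ : w₄ * z₁ * (A₄ - B₁) = 0 := by linarith only [key, t₁₁, t₂₁, t₃₁, t₄₁, t₅₁, t₁₂, t₂₂, t₃₂, t₄₂, t₅₂, t₁₃, t₂₃, t₃₃, t₄₃, t₅₃]
  have d₄₁ : A₄ - B₁ = 0 := (mul_eq_zero.mp e₄₁).resolve_left (ne_of_gt (mul_pos_of_neg_of_neg hw₄ hz₁))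
  have q₄₁ : u₄ - v₁ = 0 := by have h := m₄₁; rw [d₄₁] at h; exact abs_nonpos_iff.mp h
  have e₅₁ : w₅ * z₁ * (A₅ - B₁) = 0 := by linarith only [key, t₁₁, t₂₁, t₃₁, t₄₁, t₅₁, t₁₂, t₂₂, t₃₂, t₄₂, t₅₂, t₁₃, t₂₃, t₃₃, t₄₃, t₅₃]
  have d₅₁ : A₅ - B₁ = 0 := (mul_eq_zero.mp e₅₁).resolve_left (ne_of_gt (mul_pos_of_neg_of_neg hw₅ hz₁))
  have q₅₁ : u₅ - v₁ = 0 := by have h := m₅₁; rw [d₅₁] at h; exact abs_nonpos_iff.mp h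
  have e₁₂ : w₁ * z₂ * (A₁ - B₂) = 0 := by linarith only [key, t₁₁, t₂₁, t₃₁, t₄₁, t₅₁, t₁₂, t₂₂, t₃₂, t₄₂, t₅₂, t₁₃, t₂₃, t₃₃, t₄₃, t₅₃]
  have d₁₂ : A₁ - B₂ = 0 := (mul_eq_zero.mp e₁₂).resolve_left (ne_of_gt (mul_pos_of_neg_of_neg hw₁ hz₂))
  have q₁₂ : u₁ - v₂ = 0 := by have h := m₁₂; rw [d₁₂] at h; exact abs_nonpos_iff.mp h
  have e₁₃ : w₁ * z₃ * (A₁ - B₃) = 0 := by linarith only [key, t₁₁, t₂₁, t₃₁, t₄₁, t₅₁, t₁₂, t₂₂, t₃₂, t₄₂, t₅₂, t₁₃, t₂₃, t₃₃, t₄₃, t₅₃]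
  have d₁₃ : A₁ - B₃ = 0 := (mul_eq_zero.mp e₁₃).resolve_left (ne_of_gt (mul_pos_of_neg_of_neg hw₁ hz₃))
  have q₁₃ : u₁ - v₃ = 0 := by have h := m₁₃; rw [d₁₃] at h; exact abs_nonpos_iff.mp h
  exact ⟨sub_eq_zero.mp q₁₁, sub_eq_zero.mp q₂₁, sub_eq_zero.mp q₃₁, sub_eq_zero.mp q₄₁, sub_eq_zero.mp q₅₁,
    (sub_eq_zero.mp q₁₂).symm, (sub_eq_zero.mp q₁₃).symm⟩


/-- Abstract core of the wall lemma's consequence (positive walls): if `Σw_e = Σz_g`, `Σ_e w_eA_e = Σ_g z_gB_g`,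
all `w_e, z_g` are positive and the fifteen pairs are ample, then all eight charges coincide. -/
theorem chargesEqual_of_walls_pos (w₁ w₂ w₃ w₄ w₅ z₁ z₂ z₃ A₁ A₂ A₃ A₄ A₅ B₁ B₂ B₃ u₁ u₂ u₃ u₄ u₅ v₁ v₂ v₃ : ℝ)
    (hW : w₁ + w₂ + w₃ + w₄ + w₅ = z₁ + z₂ + z₃)
    (hP : (w₁ * A₁ + w₂ * A₂ + w₃ * A₃ + w₄ * A₄ + w₅ * A₅) - (z₁ * B₁ + z₂ * B₂ + z₃ * B₃) = 0)
    (m₁₁ : |u₁ - v₁| ≤ A₁ - B₁) (m₂₁ : |u₂ - v₁| ≤ A₂ - B₁) (m₃₁ : |u₃ - v₁| ≤ A₃ - B₁) (m₄₁ : |u₄ - v₁| ≤ A₄ - B₁) (m₅₁ : |u₅ - v₁| ≤ A₅ - B₁)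
    (m₁₂ : |u₁ - v₂| ≤ A₁ - B₂) (m₂₂ : |u₂ - v₂| ≤ A₂ - B₂) (m₃₂ : |u₃ - v₂| ≤ A₃ - B₂) (m₄₂ : |u₄ - v₂| ≤ A₄ - B₂) (m₅₂ : |u₅ - v₂| ≤ A₅ - B₂)
    (m₁₃ : |u₁ - v₃| ≤ A₁ - B₃) (m₂₃ : |u₂ - v₃| ≤ A₂ - B₃) (m₃₃ : |u₃ - v₃| ≤ A₃ - B₃) (m₄₃ : |u₄ - v₃| ≤ A₄ - B₃) (m₅₃ : |u₅ - v₃| ≤ A₅ - B₃)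
    (hw₁ : 0 < w₁) (hw₂ : 0 < w₂) (hw₃ : 0 < w₃) (hw₄ : 0 < w₄) (hw₅ : 0 < w₅)
    (hz₁ : 0 < z₁) (hz₂ : 0 < z₂) (hz₃ : 0 < z₃) :
    u₁ = v₁ ∧ u₂ = v₁ ∧ u₃ = v₁ ∧ u₄ = v₁ ∧ u₅ = v₁ ∧ v₂ = u₁ ∧ v₃ = u₁ := by
  have key := transport w₁ w₂ w₃ w₄ w₅ z₁ z₂ z₃ A₁ A₂ A₃ A₄ A₅ B₁ B₂ B₃ hW
  rw [hP, mul_zero] at key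
  have t₁₁ : 0 ≤ w₁ * z₁ * (A₁ - B₁) :=
    mul_nonneg (le_of_lt (mul_pos hw₁ hz₁)) ((abs_nonneg _).trans m₁₁)
  have t₂₁ : 0 ≤ w₂ * z₁ * (A₂ - B₁) :=
    mul_nonneg (le_of_lt (mul_pos hw₂ hz₁)) ((abs_nonneg _).trans m₂₁)
  have t₃₁ : 0 ≤ w₃ * z₁ * (A₃ - B₁) :=
    mul_nonneg (le_of_lt (mul_pos hw₃ hz₁)) ((abs_nonneg _).trans m₃₁)
  have t₄₁ : 0 ≤ w₄ * z₁ * (A₄ - B₁) :=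
    mul_nonneg (le_of_lt (mul_pos hw₄ hz₁)) ((abs_nonneg _).trans m₄₁)
  have t₅₁ : 0 ≤ w₅ * z₁ * (A₅ - B₁) :=
    mul_nonneg (le_of_lt (mul_pos hw₅ hz₁)) ((abs_nonneg _).trans m₅₁)
  have t₁₂ : 0 ≤ w₁ * z₂ * (A₁ - B₂) :=
    mul_nonneg (le_of_lt (mul_pos hw₁ hz₂)) ((abs_nonneg _).trans m₁₂)
  have t₂₂ : 0 ≤ w₂ * z₂ * (A₂ - B₂) :=
    mul_nonneg (le_of_lt (mul_pos hw₂ hz₂)) ((abs_nonneg _).trans m₂₂)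
  have t₃₂ : 0 ≤ w₃ * z₂ * (A₃ - B₂) :=
    mul_nonneg (le_of_lt (mul_pos hw₃ hz₂)) ((abs_nonneg _).trans m₃₂)
  have t₄₂ : 0 ≤ w₄ * z₂ * (A₄ - B₂) :=
    mul_nonneg (le_of_lt (mul_pos hw₄ hz₂)) ((abs_nonneg _).trans m₄₂)
  have t₅₂ : 0 ≤ w₅ * z₂ * (A₅ - B₂) :=
    mul_nonneg (le_of_lt (mul_pos hw₅ hz₂)) ((abs_nonneg _).trans m₅₂)
  have t₁₃ : 0 ≤ w₁ * z₃ * (A₁ - B₃) :=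
    mul_nonneg (le_of_lt (mul_pos hw₁ hz₃)) ((abs_nonneg _).trans m₁₃)
  have t₂₃ : 0 ≤ w₂ * z₃ * (A₂ - B₃) :=
    mul_nonneg (le_of_lt (mul_pos hw₂ hz₃)) ((abs_nonneg _).trans m₂₃)
  have t₃₃ : 0 ≤ w₃ * z₃ * (A₃ - B₃) :=
    mul_nonneg (le_of_lt (mul_pos hw₃ hz₃)) ((abs_nonneg _).trans m₃₃)
  have t₄₃ : 0 ≤ w₄ * z₃ * (A₄ - B₃) :=
    mul_nonneg (le_of_lt (mul_pos hw₄ hz₃)) ((abs_nonneg _).trans m₄₃)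
  have t₅₃ : 0 ≤ w₅ * z₃ * (A₅ - B₃) :=
    mul_nonneg (le_of_lt (mul_pos hw₅ hz₃)) ((abs_nonneg _).trans m₅₃)
  have e₁₁ : w₁ * z₁ * (A₁ - B₁) = 0 := by linarith only [key, t₁₁, t₂₁, t₃₁, t₄₁, t₅₁, t₁₂, t₂₂, t₃₂, t₄₂, t₅₂, t₁₃, t₂₃, t₃₃, t₄₃, t₅₃]
  have d₁₁ : A₁ - B₁ = 0 := (mul_eq_zero.mp e₁₁).resolve_left (ne_of_gt (mul_pos hw₁ hz₁))
  have q₁₁ : u₁ - v₁ = 0 := by have h := m₁₁; rw [d₁₁] at h; exact abs_nonpos_iff.mp h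
  have e₂₁ : w₂ * z₁ * (A₂ - B₁) = 0 := by linarith only [key, t₁₁, t₂₁, t₃₁, t₄₁, t₅₁, t₁₂, t₂₂, t₃₂, t₄₂, t₅₂, t₁₃, t₂₃, t₃₃, t₄₃, t₅₃]
  have d₂₁ : A₂ - B₁ = 0 := (mul_eq_zero.mp e₂₁).resolve_left (ne_of_gt (mul_pos hw₂ hz₁))
  have q₂₁ : u₂ - v₁ = 0 := by have h := m₂₁; rw [d₂₁] at h; exact abs_nonpos_iff.mp h
  have e₃₁ : w₃ * z₁ * (A₃ - B₁) = 0 := by linarith only [key, t₁₁, t₂₁, t₃₁, t₄₁, t₅₁, t₁₂, t₂₂, t₃₂, t₄₂, t₅₂, t₁₃, t₂₃, t₃₃, t₄₃, t₅₃]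
  have d₃₁ : A₃ - B₁ = 0 := (mul_eq_zero.mp e₃₁).resolve_left (ne_of_gt (mul_pos hw₃ hz₁))
  have q₃₁ : u₃ - v₁ = 0 := by have h := m₃₁; rw [d₃₁] at h; exact abs_nonpos_iff.mp h
  have e₄₁ : w₄ * z₁ * (A₄ - B₁) = 0 := by linarith only [key, t₁₁, t₂₁, t₃₁, t₄₁, t₅₁, t₁₂, t₂₂, t₃₂, t₄₂, t₅₂, t₁₃, t₂₃, t₃₃, t₄₃, t₅₃]
  have d₄₁ : A₄ - B₁ = 0 := (mul_eq_zero.mp e₄₁).resolve_left (ne_of_gt (mul_pos hw₄ hz₁))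
  have q₄₁ : u₄ - v₁ = 0 := by have h := m₄₁; rw [d₄₁] at h; exact abs_nonpos_iff.mp h
  have e₅₁ : w₅ * z₁ * (A₅ - B₁) = 0 := by linarith only [key, t₁₁, t₂₁, t₃₁, t₄₁, t₅₁, t₁₂, t₂₂, t₃₂, t₄₂, t₅₂, t₁₃, t₂₃, t₃₃, t₄₃, t₅₃]
  have d₅₁ : A₅ - B₁ = 0 := (mul_eq_zero.mp e₅₁).resolve_left (ne_of_gt (mul_pos hw₅ hz₁))
  have q₅₁ : u₅ - v₁ = 0 := by have h := m₅₁; rw [d₅₁] at h; exact abs_nonpos_iff.mp h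
  have e₁₂ : w₁ * z₂ * (A₁ - B₂) = 0 := by linarith only [key, t₁₁, t₂₁, t₃₁, t₄₁, t₅₁, t₁₂, t₂₂, t₃₂, t₄₂, t₅₂, t₁₃, t₂₃, t₃₃, t₄₃, t₅₃]
  have d₁₂ : A₁ - B₂ = 0 := (mul_eq_zero.mp e₁₂).resolve_left (ne_of_gt (mul_pos hw₁ hz₂))
  have q₁₂ : u₁ - v₂ = 0 := by have h := m₁₂; rw [d₁₂] at h; exact abs_nonpos_iff.mp h
  have e₁₃ : w₁ * z₃ * (A₁ - B₃) = 0 := by linarith only [key, t₁₁, t₂₁, t₃₁, t₄₁, t₅₁, t₁₂, t₂₂, t₃₂, t₄₂, t₅₂, t₁₃, t₂₃, t₃₃, t₄₃, t₅₃]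
  have d₁₃ : A₁ - B₃ = 0 := (mul_eq_zero.mp e₁₃).resolve_left (ne_of_gt (mul_pos hw₁ hz₃))
  have q₁₃ : u₁ - v₃ = 0 := by have h := m₁₃; rw [d₁₃] at h; exact abs_nonpos_iff.mp h
  exact ⟨sub_eq_zero.mp q₁₁, sub_eq_zero.mp q₂₁, sub_eq_zero.mp q₃₁, sub_eq_zero.mp q₄₁, sub_eq_zero.mp q₅₁,
    (sub_eq_zero.mp q₁₂).symm, (sub_eq_zero.mp q₁₃).symm⟩


/-- ALL WALLS NEGATIVE IS IMPOSSIBLE: a (5,3) configuration with centred positions, `P2 = 0`, pairwise ample, whose eight walls `x² − S/2`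
(`x` running over the charges) are all negative, does not exist. (Wall lemma ⟹ `A_e = B_g` for all pairs ⟹ all charges equal ⟹ walls vanish.) -/
theorem no_config_of_walls_neg (A₁ A₂ A₃ A₄ A₅ B₁ B₂ B₃ u₁ u₂ u₃ u₄ u₅ v₁ v₂ v₃ : ℝ)
    (hA : A₁ + A₂ + A₃ + A₄ + A₅ = B₁ + B₂ + B₃)
    (hP2 : (A₁ * u₁ ^ 2 + A₂ * u₂ ^ 2 + A₃ * u₃ ^ 2 + A₄ * u₄ ^ 2 + A₅ * u₅ ^ 2) - (B₁ * v₁ ^ 2 + B₂ * v₂ ^ 2 + B₃ * v₃ ^ 2) = 0)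
    (m₁₁ : |u₁ - v₁| ≤ A₁ - B₁) (m₂₁ : |u₂ - v₁| ≤ A₂ - B₁) (m₃₁ : |u₃ - v₁| ≤ A₃ - B₁) (m₄₁ : |u₄ - v₁| ≤ A₄ - B₁) (m₅₁ : |u₅ - v₁| ≤ A₅ - B₁)
    (m₁₂ : |u₁ - v₂| ≤ A₁ - B₂) (m₂₂ : |u₂ - v₂| ≤ A₂ - B₂) (m₃₂ : |u₃ - v₂| ≤ A₃ - B₂) (m₄₂ : |u₄ - v₂| ≤ A₄ - B₂) (m₅₂ : |u₅ - v₂| ≤ A₅ - B₂)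
    (m₁₃ : |u₁ - v₃| ≤ A₁ - B₃) (m₂₃ : |u₂ - v₃| ≤ A₂ - B₃) (m₃₃ : |u₃ - v₃| ≤ A₃ - B₃) (m₄₃ : |u₄ - v₃| ≤ A₄ - B₃) (m₅₃ : |u₅ - v₃| ≤ A₅ - B₃)
    (hw₁ : (u₁ ^ 2 - ((u₁ ^ 2 + u₂ ^ 2 + u₃ ^ 2 + u₄ ^ 2 + u₅ ^ 2) - (v₁ ^ 2 + v₂ ^ 2 + v₃ ^ 2)) / 2) < 0) (hw₂ : (u₂ ^ 2 - ((u₁ ^ 2 + u₂ ^ 2 + u₃ ^ 2 + u₄ ^ 2 + u₅ ^ 2) - (v₁ ^ 2 + v₂ ^ 2 + v₃ ^ 2)) / 2) < 0) (hw₃ : (u₃ ^ 2 - ((u₁ ^ 2 + u₂ ^ 2 + u₃ ^ 2 + u₄ ^ 2 + u₅ ^ 2) - (v₁ ^ 2 + v₂ ^ 2 + v₃ ^ 2)) / 2) < 0) (hw₄ : (u₄ ^ 2 - ((u₁ ^ 2 + u₂ ^ 2 + u₃ ^ 2 + u₄ ^ 2 + u₅ ^ 2) - (v₁ ^ 2 +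 v₂ ^ 2 + v₃ ^ 2)) / 2) < 0) (hw₅ : (u₅ ^ 2 - ((u₁ ^ 2 + u₂ ^ 2 + u₃ ^ 2 + u₄ ^ 2 + u₅ ^ 2) - (v₁ ^ 2 + v₂ ^ 2 + v₃ ^ 2)) / 2) < 0)
    (hz₁ : (v₁ ^ 2 - ((u₁ ^ 2 + u₂ ^ 2 + u₃ ^ 2 + u₄ ^ 2 + u₅ ^ 2) - (v₁ ^ 2 + v₂ ^ 2 + v₃ ^ 2)) / 2) < 0) (hz₂ : (v₂ ^ 2 - ((u₁ ^ 2 + u₂ ^ 2 + u₃ ^ 2 + u₄ ^ 2 + u₅ ^ 2) - (v₁ ^ 2 + v₂ ^ 2 + v₃ ^ 2)) / 2) < 0) (hz₃ : (v₃ ^ 2 - ((u₁ ^ 2 + u₂ ^ 2 + u₃ ^ 2 + u₄ ^ 2 + u₅ ^ 2) - (v₁ ^ 2 + v₂ ^ 2 + v₃ ^ 2)) / 2) < 0) : False := by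
  have hW : (u₁ ^ 2 - ((u₁ ^ 2 + u₂ ^ 2 + u₃ ^ 2 + u₄ ^ 2 + u₅ ^ 2) - (v₁ ^ 2 + v₂ ^ 2 + v₃ ^ 2)) / 2) + (u₂ ^ 2 - ((u₁ ^ 2 + u₂ ^ 2 + u₃ ^ 2 + u₄ ^ 2 + u₅ ^ 2) - (v₁ ^ 2 + v₂ ^ 2 + v₃ ^ 2)) / 2) + (u₃ ^ 2 - ((u₁ ^ 2 + u₂ ^ 2 + u₃ ^ 2 + u₄ ^ 2 + u₅ ^ 2) - (v₁ ^ 2 + v₂ ^ 2 + v₃ ^ 2)) / 2) + (u₄ ^ 2 - ((u₁ ^ 2 + u₂ ^ 2 + u₃ ^ 2 + u₄ ^ 2 + u₅ ^ 2) - (v₁ ^ 2 + v₂ ^ 2 + v₃ ^ 2)) / 2) + (u₅ ^ 2 - ((u₁ ^ 2 + u₂ ^ 2 + u₃ ^ 2 + u₄ ^ 2 + u₅ ^ 2) - (v₁ ^ 2 + v₂ ^ 2 + v₃ ^ 2)) / 2) = (v₁ ^ 2 - ((u₁ ^ 2 + u₂ ^ 2 + u₃ ^ 2 + u₄ ^ 2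 + u₅ ^ 2) - (v₁ ^ 2 + v₂ ^ 2 + v₃ ^ 2)) / 2) + (v₂ ^ 2 - ((u₁ ^ 2 + u₂ ^ 2 + u₃ ^ 2 + u₄ ^ 2 + u₅ ^ 2) - (v₁ ^ 2 + v₂ ^ 2 + v₃ ^ 2)) / 2) + (v₃ ^ 2 - ((u₁ ^ 2 + u₂ ^ 2 + u₃ ^ 2 + u₄ ^ 2 + u₅ ^ 2) - (v₁ ^ 2 + v₂ ^ 2 + v₃ ^ 2)) / 2) := by ring
  have hP2' : ((u₁ ^ 2 - ((u₁ ^ 2 + u₂ ^ 2 + u₃ ^ 2 + u₄ ^ 2 + u₅ ^ 2) - (v₁ ^ 2 + v₂ ^ 2 + v₃ ^ 2)) / 2) * A₁ + (u₂ ^ 2 - ((u₁ ^ 2 + u₂ ^ 2 + u₃ ^ 2 + u₄ ^ 2 + u₅ ^ 2) - (v₁ ^ 2 + v₂ ^ 2 + v₃ ^ 2)) / 2) * A₂ + (u₃ ^ 2 - ((u₁ ^ 2 + u₂ ^ 2 + u₃ ^ 2 + u₄ ^ 2 + u₅ ^ 2) - (v₁ ^ 2 + v₂ ^ 2 + v₃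 ^ 2)) / 2) * A₃ + (u₄ ^ 2 - ((u₁ ^ 2 + u₂ ^ 2 + u₃ ^ 2 + u₄ ^ 2 + u₅ ^ 2) - (v₁ ^ 2 + v₂ ^ 2 + v₃ ^ 2)) / 2) * A₄ + (u₅ ^ 2 - ((u₁ ^ 2 + u₂ ^ 2 + u₃ ^ 2 + u₄ ^ 2 + u₅ ^ 2) - (v₁ ^ 2 + v₂ ^ 2 + v₃ ^ 2)) / 2) * A₅) - ((v₁ ^ 2 - ((u₁ ^ 2 + u₂ ^ 2 + u₃ ^ 2 + u₄ ^ 2 + u₅ ^ 2) - (v₁ ^ 2 + v₂ ^ 2 + v₃ ^ 2)) / 2) * B₁ + (v₂ ^ 2 - ((u₁ ^ 2 + u₂ ^ 2 + u₃ ^ 2 + u₄ ^ 2 + u₅ ^ 2) - (v₁ ^ 2 + v₂ ^ 2 + v₃ ^ 2)) / 2) * B₂ + (v₃ ^ 2 - ((u₁ ^ 2 + u₂ ^ 2 + u₃ ^ 2 + u₄ ^ 2 + u₅ ^ 2) - (v₁ ^ 2 + v₂ ^ 2 + v₃ ^ 2)) / 2) * B₃) = 0 := by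
    have hB : B₃ = A₁ + A₂ + A₃ + A₄ + A₅ - B₁ - B₂ := by linarith
    subst hB
    linear_combination hP2
  obtain ⟨e₁, e₂, e₃, e₄, e₅, f₂, f₃⟩ := chargesEqual_of_walls_neg (u₁ ^ 2 - ((u₁ ^ 2 + u₂ ^ 2 + u₃ ^ 2 + u₄ ^ 2 + u₅ ^ 2) - (v₁ ^ 2 + v₂ ^ 2 + v₃ ^ 2)) / 2) (u₂ ^ 2 - ((u₁ ^ 2 + u₂ ^ 2 + u₃ ^ 2 + u₄ ^ 2 + u₅ ^ 2) - (v₁ ^ 2 + v₂ ^ 2 + v₃ ^ 2)) / 2) (u₃ ^ 2 - ((u₁ ^ 2 + u₂ ^ 2 + u₃ ^ 2 + u₄ ^ 2 + u₅ ^ 2) - (v₁ ^ 2 + v₂ ^ 2 + v₃ ^ 2)) / 2) (u₄ ^ 2 - ((u₁ ^ 2 + u₂ ^ 2 + u₃ ^ 2 + u₄ ^ 2 + u₅ ^ 2) - (v₁ ^ 2 + v₂ ^ 2 + v₃ ^ 2)) / 2) (u₅ ^ 2 - ((u₁ ^ 2 + u₂ ^ 2 + u₃ ^ 2 + u₄ ^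 2 + u₅ ^ 2) - (v₁ ^ 2 + v₂ ^ 2 + v₃ ^ 2)) / 2) (v₁ ^ 2 - ((u₁ ^ 2 + u₂ ^ 2 + u₃ ^ 2 + u₄ ^ 2 + u₅ ^ 2) - (v₁ ^ 2 + v₂ ^ 2 + v₃ ^ 2)) / 2) (v₂ ^ 2 - ((u₁ ^ 2 + u₂ ^ 2 + u₃ ^ 2 + u₄ ^ 2 + u₅ ^ 2) - (v₁ ^ 2 + v₂ ^ 2 + v₃ ^ 2)) / 2) (v₃ ^ 2 - ((u₁ ^ 2 + u₂ ^ 2 + u₃ ^ 2 + u₄ ^ 2 + u₅ ^ 2) - (v₁ ^ 2 + v₂ ^ 2 + v₃ ^ 2)) / 2) A₁ A₂ A₃ A₄ A₅ B₁ B₂ B₃ u₁ u₂ u₃ u₄ u₅ v₁ v₂ v₃ hW hP2'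
    m₁₁ m₂₁ m₃₁ m₄₁ m₅₁ m₁₂ m₂₂ m₃₂ m₄₂ m₅₂ m₁₃ m₂₃ m₃₃ m₄₃ m₅₃ hw₁ hw₂ hw₃ hw₄ hw₅ hz₁ hz₂ hz₃
  subst e₂ e₃ e₄ e₅ f₂ f₃
  subst e₁
  linarith only [hw₁]


/-- ALL WALLS POSITIVE IS IMPOSSIBLE: a (5,3) configuration with centred positions, `P2 = 0`, pairwise ample, whose eight walls `x² − S/2`
(`x` running over the charges) are all positive, does not exist. (Wall lemma ⟹ `A_e = B_g` for all pairs ⟹ all charges equal ⟹ walls vanish.) -/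
theorem no_config_of_walls_pos (A₁ A₂ A₃ A₄ A₅ B₁ B₂ B₃ u₁ u₂ u₃ u₄ u₅ v₁ v₂ v₃ : ℝ)
    (hA : A₁ + A₂ + A₃ + A₄ + A₅ = B₁ + B₂ + B₃)
    (hP2 : (A₁ * u₁ ^ 2 + A₂ * u₂ ^ 2 + A₃ * u₃ ^ 2 + A₄ * u₄ ^ 2 + A₅ * u₅ ^ 2) - (B₁ * v₁ ^ 2 + B₂ * v₂ ^ 2 + B₃ * v₃ ^ 2) = 0)
    (m₁₁ : |u₁ - v₁| ≤ A₁ - B₁) (m₂₁ : |u₂ - v₁| ≤ A₂ - B₁) (m₃₁ : |u₃ - v₁| ≤ A₃ - B₁) (m₄₁ : |u₄ - v₁| ≤ A₄ - B₁) (m₅₁ : |u₅ - v₁| ≤ A₅ - B₁)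
    (m₁₂ : |u₁ - v₂| ≤ A₁ - B₂) (m₂₂ : |u₂ - v₂| ≤ A₂ - B₂) (m₃₂ : |u₃ - v₂| ≤ A₃ - B₂) (m₄₂ : |u₄ - v₂| ≤ A₄ - B₂) (m₅₂ : |u₅ - v₂| ≤ A₅ - B₂)
    (m₁₃ : |u₁ - v₃| ≤ A₁ - B₃) (m₂₃ : |u₂ - v₃| ≤ A₂ - B₃) (m₃₃ : |u₃ - v₃| ≤ A₃ - B₃) (m₄₃ : |u₄ - v₃| ≤ A₄ - B₃) (m₅₃ : |u₅ - v₃| ≤ A₅ - B₃)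
    (hw₁ : 0 < (u₁ ^ 2 - ((u₁ ^ 2 + u₂ ^ 2 + u₃ ^ 2 + u₄ ^ 2 + u₅ ^ 2) - (v₁ ^ 2 + v₂ ^ 2 + v₃ ^ 2)) / 2)) (hw₂ : 0 < (u₂ ^ 2 - ((u₁ ^ 2 + u₂ ^ 2 + u₃ ^ 2 + u₄ ^ 2 + u₅ ^ 2) - (v₁ ^ 2 + v₂ ^ 2 + v₃ ^ 2)) / 2)) (hw₃ : 0 < (u₃ ^ 2 - ((u₁ ^ 2 + u₂ ^ 2 + u₃ ^ 2 + u₄ ^ 2 + u₅ ^ 2) - (v₁ ^ 2 + v₂ ^ 2 + v₃ ^ 2)) / 2)) (hw₄ : 0 < (u₄ ^ 2 - ((u₁ ^ 2 + u₂ ^ 2 + u₃ ^ 2 + u₄ ^ 2 + u₅ ^ 2) - (v₁ ^ 2 + v₂ ^ 2 + v₃ ^ 2)) / 2)) (hw₅ : 0 < (u₅ ^ 2 - ((u₁ ^ 2 + u₂ ^ 2 + u₃ ^ 2 + u₄ ^ 2 + u₅ ^ 2) - (v₁ ^ 2 + v₂ ^ 2 + v₃ ^ 2)) / 2))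
    (hz₁ : 0 < (v₁ ^ 2 - ((u₁ ^ 2 + u₂ ^ 2 + u₃ ^ 2 + u₄ ^ 2 + u₅ ^ 2) - (v₁ ^ 2 + v₂ ^ 2 + v₃ ^ 2)) / 2)) (hz₂ : 0 < (v₂ ^ 2 - ((u₁ ^ 2 + u₂ ^ 2 + u₃ ^ 2 + u₄ ^ 2 + u₅ ^ 2) - (v₁ ^ 2 + v₂ ^ 2 + v₃ ^ 2)) / 2)) (hz₃ : 0 < (v₃ ^ 2 - ((u₁ ^ 2 + u₂ ^ 2 + u₃ ^ 2 + u₄ ^ 2 + u₅ ^ 2) - (v₁ ^ 2 + v₂ ^ 2 + v₃ ^ 2)) / 2)) : False := by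
  have hW : (u₁ ^ 2 - ((u₁ ^ 2 + u₂ ^ 2 + u₃ ^ 2 + u₄ ^ 2 + u₅ ^ 2) - (v₁ ^ 2 + v₂ ^ 2 + v₃ ^ 2)) / 2) + (u₂ ^ 2 - ((u₁ ^ 2 + u₂ ^ 2 + u₃ ^ 2 + u₄ ^ 2 + u₅ ^ 2) - (v₁ ^ 2 + v₂ ^ 2 + v₃ ^ 2)) / 2) + (u₃ ^ 2 - ((u₁ ^ 2 + u₂ ^ 2 + u₃ ^ 2 + u₄ ^ 2 + u₅ ^ 2) - (v₁ ^ 2 + v₂ ^ 2 + v₃ ^ 2)) / 2) + (u₄ ^ 2 - ((u₁ ^ 2 + u₂ ^ 2 + u₃ ^ 2 + u₄ ^ 2 + u₅ ^ 2) - (v₁ ^ 2 + v₂ ^ 2 + v₃ ^ 2)) / 2) + (u₅ ^ 2 - ((u₁ ^ 2 + u₂ ^ 2 + u₃ ^ 2 + u₄ ^ 2 + u₅ ^ 2) - (v₁ ^ 2 + v₂ ^ 2 + v₃ ^ 2)) / 2) = (v₁ ^ 2 - ((u₁ ^ 2 + u₂ ^ 2 + u₃ ^ 2 + u₄ ^ 2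 + u₅ ^ 2) - (v₁ ^ 2 + v₂ ^ 2 + v₃ ^ 2)) / 2) + (v₂ ^ 2 - ((u₁ ^ 2 + u₂ ^ 2 + u₃ ^ 2 + u₄ ^ 2 + u₅ ^ 2) - (v₁ ^ 2 + v₂ ^ 2 + v₃ ^ 2)) / 2) + (v₃ ^ 2 - ((u₁ ^ 2 + u₂ ^ 2 + u₃ ^ 2 + u₄ ^ 2 + u₅ ^ 2) - (v₁ ^ 2 + v₂ ^ 2 + v₃ ^ 2)) / 2) := by ring
  have hP2' : ((u₁ ^ 2 - ((u₁ ^ 2 + u₂ ^ 2 + u₃ ^ 2 + u₄ ^ 2 + u₅ ^ 2) - (v₁ ^ 2 + v₂ ^ 2 + v₃ ^ 2)) / 2) * A₁ + (u₂ ^ 2 - ((u₁ ^ 2 + u₂ ^ 2 + u₃ ^ 2 + u₄ ^ 2 + u₅ ^ 2) - (v₁ ^ 2 + v₂ ^ 2 + v₃ ^ 2)) / 2) * A₂ + (u₃ ^ 2 - ((u₁ ^ 2 + u₂ ^ 2 + u₃ ^ 2 + u₄ ^ 2 + u₅ ^ 2) - (v₁ ^ 2 + v₂ ^ 2 + v₃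 ^ 2)) / 2) * A₃ + (u₄ ^ 2 - ((u₁ ^ 2 + u₂ ^ 2 + u₃ ^ 2 + u₄ ^ 2 + u₅ ^ 2) - (v₁ ^ 2 + v₂ ^ 2 + v₃ ^ 2)) / 2) * A₄ + (u₅ ^ 2 - ((u₁ ^ 2 + u₂ ^ 2 + u₃ ^ 2 + u₄ ^ 2 + u₅ ^ 2) - (v₁ ^ 2 + v₂ ^ 2 + v₃ ^ 2)) / 2) * A₅) - ((v₁ ^ 2 - ((u₁ ^ 2 + u₂ ^ 2 + u₃ ^ 2 + u₄ ^ 2 + u₅ ^ 2) - (v₁ ^ 2 + v₂ ^ 2 + v₃ ^ 2)) / 2) * B₁ + (v₂ ^ 2 - ((u₁ ^ 2 + u₂ ^ 2 + u₃ ^ 2 + u₄ ^ 2 + u₅ ^ 2) - (v₁ ^ 2 + v₂ ^ 2 + v₃ ^ 2)) / 2) * B₂ + (v₃ ^ 2 - ((u₁ ^ 2 + u₂ ^ 2 + u₃ ^ 2 + u₄ ^ 2 + u₅ ^ 2) - (v₁ ^ 2 + v₂ ^ 2 + v₃ ^ 2)) / 2) * B₃) = 0 := by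
    have hB : B₃ = A₁ + A₂ + A₃ + A₄ + A₅ - B₁ - B₂ := by linarith
    subst hB
    linear_combination hP2
  obtain ⟨e₁, e₂, e₃, e₄, e₅, f₂, f₃⟩ := chargesEqual_of_walls_pos (u₁ ^ 2 - ((u₁ ^ 2 + u₂ ^ 2 + u₃ ^ 2 + u₄ ^ 2 + u₅ ^ 2) - (v₁ ^ 2 + v₂ ^ 2 + v₃ ^ 2)) / 2) (u₂ ^ 2 - ((u₁ ^ 2 + u₂ ^ 2 + u₃ ^ 2 + u₄ ^ 2 + u₅ ^ 2) - (v₁ ^ 2 + v₂ ^ 2 + v₃ ^ 2)) / 2) (u₃ ^ 2 - ((u₁ ^ 2 + u₂ ^ 2 + u₃ ^ 2 + u₄ ^ 2 + u₅ ^ 2) - (v₁ ^ 2 + v₂ ^ 2 + v₃ ^ 2)) / 2) (u₄ ^ 2 - ((u₁ ^ 2 + u₂ ^ 2 + u₃ ^ 2 + u₄ ^ 2 + u₅ ^ 2) - (v₁ ^ 2 + v₂ ^ 2 + v₃ ^ 2)) / 2) (u₅ ^ 2 - ((u₁ ^ 2 + u₂ ^ 2 + u₃ ^ 2 + u₄ ^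 2 + u₅ ^ 2) - (v₁ ^ 2 + v₂ ^ 2 + v₃ ^ 2)) / 2) (v₁ ^ 2 - ((u₁ ^ 2 + u₂ ^ 2 + u₃ ^ 2 + u₄ ^ 2 + u₅ ^ 2) - (v₁ ^ 2 + v₂ ^ 2 + v₃ ^ 2)) / 2) (v₂ ^ 2 - ((u₁ ^ 2 + u₂ ^ 2 + u₃ ^ 2 + u₄ ^ 2 + u₅ ^ 2) - (v₁ ^ 2 + v₂ ^ 2 + v₃ ^ 2)) / 2) (v₃ ^ 2 - ((u₁ ^ 2 + u₂ ^ 2 + u₃ ^ 2 + u₄ ^ 2 + u₅ ^ 2) - (v₁ ^ 2 + v₂ ^ 2 + v₃ ^ 2)) / 2) A₁ A₂ A₃ A₄ A₅ B₁ B₂ B₃ u₁ u₂ u₃ u₄ u₅ v₁ v₂ v₃ hW hP2'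
    m₁₁ m₂₁ m₃₁ m₄₁ m₅₁ m₁₂ m₂₂ m₃₂ m₄₂ m₅₂ m₁₃ m₂₃ m₃₃ m₄₃ m₅₃ hw₁ hw₂ hw₃ hw₄ hw₅ hz₁ hz₂ hz₃
  subst e₂ e₃ e₄ e₅ f₂ f₃
  subst e₁
  linarith only [hw₁]


end Summit.HodgeConjecture.HodgeConjecture.WeilClassTestFormatFiveThreeLineQuintic
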